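import Mathlib

/-!
# Route PlaneEnergyCeiling · crux `BoundedPlanarEnergyRegularity` — planar-energy bookkeeping of
# the velocity-record zoom

Helper file for the crux item stmt-NavierStokesRegularity-16921 (`BoundedPlanarEnergyRegularity`,
route `PlaneEnergyCeiling`), serving the zoom stub of its line `birth`
(`stub_planarEnergyZoom` = support item stmt-NavierStokesRegularity-16858, "exact scale invariance
of `E` + Fatou under locally uniform convergence"). Mathlib only. Write `P y h = (y₀, y₁, h) ∈ ℝ³`
for `y ∈ ℝ²` and `E(u; R, h) = ∫⁻_y ‖u (R (P y h))‖ₑ²` for the planar kinetic energy of a field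
`u` through the plane `R({x₂ = h})`, `R` a linear isometry.

* `planarEnergy_zoom_eq` — **exact invariance of planar energies under the KNSS rescaling**
  `u ↦ c • u (x₀ + c • ·)`, `c > 0`: the planar energy of the rescaled field through `R({x₂ = h})`
  equals the planar energy of `u` through the image plane `R({x₂ = (R⁻¹x₀)₂ + c h})` (the factor
  `c²` of `‖c • u‖²` cancels the Jacobian `c⁻²` of the induced affine map of the plane `ℝ²`).
  Hence a planar bound `≤ M` on every plane passes unchanged to every rescaled field.
* `planarEnergy_le_of_tendsto` — **planar Fatou**: if continuous fields `v k` converge pointwise to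
  `w` and each has planar energy `≤ M` through a fixed plane, so does `w`
  (`lintegral_liminf_le'`). Hence the bound passes to pointwise (a fortiori locally uniform)
  limits of rescaled fields, plane by plane and slice by slice.
-/

noncomputable section

-- single-conjunct summit: `Summit.<Summit>.<Problem>` repeats the name by the D-0017 layout
set_option linter.dupNamespace false

namespace Summit.NavierStokesRegularity.NavierStokesRegularity.Theorems.BoundedPlanarEnergyRegularity

open MeasureTheory Set Filter Topology WithLp
open scoped ENNReal

/-- Affine substitution in the plane: `∫⁻ G (a + c • y) dy = c⁻² ∫⁻ G` on `ℝ²` for `c ≠ 0`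
(translation invariance and `Measure.map_addHaar_smul`). -/
theorem lintegral_comp_add_smul_two (G : EuclideanSpace ℝ (Fin 2) → ℝ≥0∞) (a : EuclideanSpace ℝ (Fin 2))
    {c : ℝ} (hc : c ≠ 0) :
    ∫⁻ y, G (a + c • y) = ENNReal.ofReal ((c ^ 2)⁻¹) * ∫⁻ y, G y := by
  have h1 : (fun y => G (a + c • y)) = fun y => (fun z => G (c • z)) (y + c⁻¹ • a) := by
    funext y
    simp only [smul_add, smul_smul, mul_inv_cancel₀ hc, one_smul, add_comm]
  rw [h1, lintegral_add_right_eq_self (fun z => G (c • z)) (c⁻¹ • a)]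
  calc ∫⁻ y, G (c • y) = ∫⁻ y, G y ∂(Measure.map (fun x : EuclideanSpace ℝ (Fin 2) => c • x) volume) :=
        (lintegral_map_equiv G
          (Homeomorph.smul (isUnit_iff_ne_zero.2 hc).unit).toMeasurableEquiv).symm
    _ = ENNReal.ofReal ((c ^ 2)⁻¹) * ∫⁻ y, G y := by
        rw [Measure.map_addHaar_smul volume hc, lintegral_smul_measure, smul_eq_mul,
          finrank_euclideanSpace_fin, abs_of_nonneg (by positivity)]

/-- **Exact invariance of planar energies under the KNSS rescaling.** For a field `u` on `ℝ³`, a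
centre `x₀`, a scale `c > 0`, a linear isometry `R` and a height `h`: the planar energy of the
rescaled field `x ↦ c • u (x₀ + c • x)` through the plane `R({x₂ = h})` equals the planar energy of
`u` through `R({x₂ = (R⁻¹ x₀)₂ + c h})`. -/
theorem planarEnergy_zoom_eq :
    ∀ (u : EuclideanSpace ℝ (Fin 3) → EuclideanSpace ℝ (Fin 3)) (x₀ : EuclideanSpace ℝ (Fin 3)) (c : ℝ), 0 < c →
      ∀ (R : EuclideanSpace ℝ (Fin 3) ≃ₗᵢ[ℝ] EuclideanSpace ℝ (Fin 3)) (h : ℝ),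
        ∫⁻ y : EuclideanSpace ℝ (Fin 2), ‖c • u (x₀ + c • R (WithLp.toLp 2 ![y 0, y 1, h]))‖ₑ ^ 2 =
          ∫⁻ y : EuclideanSpace ℝ (Fin 2), ‖u (R (WithLp.toLp 2 ![y 0, y 1, (R.symm x₀) 2 + c * h]))‖ₑ ^ 2 := by
  intro u x₀ c hc R h
  -- the in-plane part `a ∈ ℝ²` and the height `b` of `R⁻¹ x₀`
  set a : EuclideanSpace ℝ (Fin 2) := toLp 2 ![(R.symm x₀) 0, (R.symm x₀) 1] with ha
  set b : ℝ := (R.symm x₀) 2 with hb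
  set G : EuclideanSpace ℝ (Fin 2) → ℝ≥0∞ := fun w => ‖u (R (toLp 2 ![w 0, w 1, b + c * h]))‖ₑ ^ 2
    with hG
  -- the rescaled point is `R (P (a + c y) (b + c h))`
  have hpt : ∀ y : EuclideanSpace ℝ (Fin 2),
      x₀ + c • R (toLp 2 ![y 0, y 1, h]) =
        R (toLp 2 ![(a + c • y) 0, (a + c • y) 1, b + c * h]) := by
    intro y
    have hx₀ : x₀ = R (R.symm x₀) := (R.apply_symm_apply x₀).symm
    conv_lhs => rw [hx₀]
    rw [← LinearIsometryEquiv.map_smul, ← LinearIsometryEquiv.map_add]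
    congr 1
    ext i
    fin_cases i <;> simp [ha, hb]
  have hint : ∀ y : EuclideanSpace ℝ (Fin 2),
      ‖c • u (x₀ + c • R (toLp 2 ![y 0, y 1, h]))‖ₑ ^ 2 = ENNReal.ofReal (c ^ 2) * G (a + c • y) := by
    intro y
    rw [hpt y, enorm_smul, mul_pow, hG]
    congr 1
    rw [Real.enorm_eq_ofReal hc.le, ← ENNReal.ofReal_pow hc.le]
  simp_rw [hint]
  rw [lintegral_const_mul' _ _ ENNReal.ofReal_ne_top, lintegral_comp_add_smul_two G a hc.ne',
    ← mul_assoc, ← ENNReal.ofReal_mul (by positivity), mul_inv_cancel₀ (by positivity),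
    ENNReal.ofReal_one, one_mul]

/-- **Planar Fatou.** If continuous fields `v k` on `ℝ³` converge pointwise to `w` and each has
planar energy at most `M` through the plane `R({x₂ = h})`, then so does `w`. -/
theorem planarEnergy_le_of_tendsto :
    ∀ (v : ℕ → EuclideanSpace ℝ (Fin 3) → EuclideanSpace ℝ (Fin 3)) (w : EuclideanSpace ℝ (Fin 3) → EuclideanSpace ℝ (Fin 3)),
      (∀ k, Continuous (v k)) → (∀ x, Filter.Tendsto (fun k => v k x) Filter.atTop (nhds (w x))) →
      ∀ (R : EuclideanSpace ℝ (Fin 3) ≃ₗᵢ[ℝ] EuclideanSpace ℝ (Fin 3)) (h : ℝ) (M : ENNReal),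
        (∀ k, ∫⁻ y : EuclideanSpace ℝ (Fin 2), ‖v k (R (WithLp.toLp 2 ![y 0, y 1, h]))‖ₑ ^ 2 ≤ M) →
          ∫⁻ y : EuclideanSpace ℝ (Fin 2), ‖w (R (WithLp.toLp 2 ![y 0, y 1, h]))‖ₑ ^ 2 ≤ M := by
  intro v w hv hlim R h M hb
  have hP : Continuous fun y : EuclideanSpace ℝ (Fin 2) => (toLp 2 ![y 0, y 1, h] : EuclideanSpace ℝ (Fin 3)) := by
    refine (PiLp.continuous_toLp 2 _).comp ?_
    refine continuous_pi fun i => ?_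
    fin_cases i
    · exact (PiLp.continuous_apply 2 _ 0 : Continuous fun y : EuclideanSpace ℝ (Fin 2) => y 0)
    · exact (PiLp.continuous_apply 2 _ 1 : Continuous fun y : EuclideanSpace ℝ (Fin 2) => y 1)
    · exact continuous_const
  have hmeas : ∀ k, AEMeasurable
      (fun y : EuclideanSpace ℝ (Fin 2) => ‖v k (R (toLp 2 ![y 0, y 1, h]))‖ₑ ^ 2) volume := fun k =>
    (((hv k).comp (R.continuous.comp hP)).measurable.enorm.pow_const 2).aemeasurable
  have hptw : ∀ y : EuclideanSpace ℝ (Fin 2),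
      ‖w (R (toLp 2 ![y 0, y 1, h]))‖ₑ ^ 2 =
        liminf (fun k => ‖v k (R (toLp 2 ![y 0, y 1, h]))‖ₑ ^ 2) atTop := by
    intro y
    refine (Tendsto.liminf_eq ?_).symm
    exact ENNReal.Tendsto.pow ((continuous_enorm.tendsto _).comp (hlim _))
  calc ∫⁻ y : EuclideanSpace ℝ (Fin 2), ‖w (R (toLp 2 ![y 0, y 1, h]))‖ₑ ^ 2
      = ∫⁻ y : EuclideanSpace ℝ (Fin 2),
          liminf (fun k => ‖v k (R (toLp 2 ![y 0, y 1, h]))‖ₑ ^ 2) atTop := lintegral_congr hptw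
    _ ≤ liminf (fun k => ∫⁻ y : EuclideanSpace ℝ (Fin 2), ‖v k (R (toLp 2 ![y 0, y 1, h]))‖ₑ ^ 2) atTop :=
        lintegral_liminf_le' hmeas
    _ ≤ M := liminf_le_of_frequently_le' (Frequently.of_forall hb)

end Summit.NavierStokesRegularity.NavierStokesRegularity.Theorems.BoundedPlanarEnergyRegularity

end
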